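import Mathlib
import HarnessLib
import Summits.HubbardSuperconductivity.HubbardSuperconductivity.Theorems.KLProgrammeH10TwoPointLimitSymbolFrameProfile
import Summits.HubbardSuperconductivity.HubbardSuperconductivity.Theorems.KLProgrammeH10TwoPointLimitSymbolFrameBand
import Summits.HubbardSuperconductivity.HubbardSuperconductivity.Theorems.KLProgrammePerturbedFermiCurveHigherDerivsFrame

/-!
# Route `KLProgramme` — engine support, route (L2) symbol layer at ORDER THREE: the cutoff PROFILE at scale `n` with its first THREE derivatives
# (`|Gₙ‴| ≤ d e₀⁶/Λ_n⁶`), and the `C³` size of the frame band on `Fin 2 → ℝ` (`‖D³(e_K ∘ toLp)‖ ≤ 4 + 8A₃`)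

Cell `gate-hubbard-kl`, seat p3 (g10); the order-three supplements of p4's `…H10TwoPointLimitSymbolFrameProfile` (`d ≥ |χ′|, |χ″|`) and
`…SymbolFrameBand` (`‖D²(e_K∘toLp)‖ ≤ 4 + 4A`), for W1 of the (E4)ₙ supply of stmt-HubbardSuperconductivity-20437 (located risk «(b)-Wt@j≥1», cure
W1-MIXED: third differences at the isotropic rates).

* `exists_abs_derivs3_bgmCutoffSq_le` — `∃ d ≥ 0` bounding `|bgmCutoffSq′|, |bgmCutoffSq″|, |bgmCutoffSq‴|` globally;
* **`scaleProfile_bounds₃`** — `Gₙ(u) = bgmCutoffSq e₀ (16ⁿ u)`: `Gₙ ∈ C³`, `|Gₙ| ≤ 1`, `|Gₙ′| ≤ d e₀²/Λ_n²`, `|Gₙ″| ≤ d e₀⁴/Λ_n⁴`, `|Gₙ‴| ≤ d e₀⁶/Λ_n⁶`, `Gₙ = 0`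
  above `Λ_n²` (`Λ_n = klScale e₀ n`, `16ⁿ = e₀²/Λ_n²`);
* **`norm_iteratedFDeriv_three_frameBand_le`** — if `‖D³(frameShift K)‖ ≤ A₃` on `Momentum` then `‖D³(p ↦ e_K(toLp p))‖ ≤ 4 + 8A₃`
  (`‖D³ε₀‖ ≤ 4`, `norm_iteratedFDeriv_frameShift_toLp_le_single`).  On the flow frame `K_n` the history's (I-F jets) give `A₃ = Gfr₃U²(4ⁿ − 1)/3`.

Everything is proved; no definitions, no named facts. [folklore]
-/

noncomputable section

namespace Summit.HubbardSuperconductivity.HubbardSuperconductivity.Theorems.TorusFourierL2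

set_option linter.dupNamespace false -- summit = problem name (single-conjunct summit), D-0017

open Set Filter Topology Literature.MathematicalPhysics.QuantumLattice Literature.MathematicalPhysics.QuantumLattice.BandSectorCounting
open Literature.MathematicalPhysics.QuantumLattice.FermiRG Literature.Probability.LatticeModels
open Summit.HubbardSuperconductivity.HubbardSuperconductivity.Theorems.DispersionFlow
open Summit.HubbardSuperconductivity.HubbardSuperconductivity.Theorems.KLRegimeSplit
open Summit.HubbardSuperconductivity.HubbardSuperconductivity.Theorems.KLProgrammeLegKernels
open Summit.HubbardSuperconductivity.HubbardSuperconductivity.Theorems.PerturbedFermiCurve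
open scoped Real

/-! ### §1 The surrogate's first three derivatives are globally bounded -/

/-- **The first three derivatives of the surrogate are globally bounded**: `∃ d ≥ 0, |bgmCutoffSq′|, |bgmCutoffSq″|, |bgmCutoffSq‴| ≤ d`
(they vanish off the compact transition interval `[e₀²/16, e₀²]` and are continuous). [folklore] -/
theorem exists_abs_derivs3_bgmCutoffSq_le {e₀ : ℝ} (he : 0 < e₀) :
    ∃ d : ℝ, 0 ≤ d ∧ (∀ u, |deriv (bgmCutoffSq e₀) u| ≤ d) ∧ (∀ u, |iteratedDeriv 2 (bgmCutoffSq e₀) u| ≤ d) ∧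
      (∀ u, |iteratedDeriv 3 (bgmCutoffSq e₀) u| ≤ d) := by
  have hC : ∀ m : ℕ, ContDiff ℝ m (bgmCutoffSq e₀) := fun m => contDiff_bgmCutoffSq he
  have hvan : ∀ (m : ℕ), 1 ≤ m → ∀ u, (u < e₀ ^ 2 / 16 ∨ e₀ ^ 2 < u) → iteratedDeriv m (bgmCutoffSq e₀) u = 0 := by
    intro m hm u hu
    rcases hu with hu | hu
    · have hev : bgmCutoffSq e₀ =ᶠ[𝓝 u] fun _ => (1 : ℝ) := by
        filter_upwards [Iio_mem_nhds hu] with v hv using (bgmCutoffSq_eq_const he).1 hv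
      rw [hev.iteratedDeriv_eq, iteratedDeriv_const]; simp [show m ≠ 0 by omega]
    · have hev : bgmCutoffSq e₀ =ᶠ[𝓝 u] fun _ => (0 : ℝ) := by
        filter_upwards [Ioi_mem_nhds hu] with v hv using (bgmCutoffSq_eq_const he).2 hv
      rw [hev.iteratedDeriv_eq, iteratedDeriv_const]; simp
  have hbd : ∀ m : ℕ, 1 ≤ m → ∃ C, 0 ≤ C ∧ ∀ u, |iteratedDeriv m (bgmCutoffSq e₀) u| ≤ C := by
    intro m hm
    have hcont : Continuous (iteratedDeriv m (bgmCutoffSq e₀)) := (hC m).continuous_iteratedDeriv' m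
    obtain ⟨C, hC'⟩ := (isCompact_Icc (a := e₀ ^ 2 / 16) (b := e₀ ^ 2)).exists_bound_of_continuousOn hcont.continuousOn
    refine ⟨max C 0, le_max_right _ _, fun u => ?_⟩
    by_cases hu : u ∈ Icc (e₀ ^ 2 / 16) (e₀ ^ 2)
    · exact ((Real.norm_eq_abs _).symm.le.trans (hC' u hu)).trans (le_max_left _ _)
    · rw [mem_Icc, not_and_or, not_le, not_le] at hu
      rw [hvan m hm u hu, abs_zero]; exact le_max_right _ _
  obtain ⟨C₁, hC₁0, hC₁⟩ := hbd 1 le_rfl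
  obtain ⟨C₂, -, hC₂⟩ := hbd 2 (by norm_num)
  obtain ⟨C₃, -, hC₃⟩ := hbd 3 (by norm_num)
  refine ⟨max (max C₁ C₂) C₃, le_max_of_le_left (le_max_of_le_left hC₁0), fun u => ?_, fun u => ?_, fun u => ?_⟩
  · have h := hC₁ u
    rw [iteratedDeriv_one] at h
    exact h.trans ((le_max_left _ _).trans (le_max_left _ _))
  · exact (hC₂ u).trans ((le_max_right _ _).trans (le_max_left _ _))
  · exact (hC₃ u).trans (le_max_right _ _)

/-! ### §2 The rescaled profile of scale `n` at order three -/

/-- `(g(c·))‴(u) = c³·g‴(c·u)` for `g ∈ C³`. [folklore] -/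
theorem iteratedDeriv_three_comp_mul_left {g : ℝ → ℝ} (hg : ContDiff ℝ 3 g) (c u : ℝ) :
    iteratedDeriv 3 (fun u => g (c * u)) u = c ^ 3 * iteratedDeriv 3 g (c * u) := by
  rw [iteratedDeriv_comp_const_mul hg c]

/-- **The scale-`n` profile satisfies the generic ORDER-THREE profile hypotheses** with `Λ = Λ_n = klScale e₀ n`: for
`Gₙ(u) = bgmCutoffSq e₀ (16ⁿ u)` and `d` a bound of `|bgmCutoffSq′|, |bgmCutoffSq″|, |bgmCutoffSq‴|`: `Gₙ ∈ C³`, `|Gₙ| ≤ 1`, `|Gₙ′| ≤ d e₀²/Λ_n²`,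
`|Gₙ″| ≤ d e₀⁴/Λ_n⁴`, `|Gₙ‴| ≤ d e₀⁶/Λ_n⁶`, `Gₙ(u) = 0` for `u > Λ_n²`. [cite: BenfattoGiulianiMastropietro2006, §2.3 (2.19), §2.5 (2.53)] -/
theorem scaleProfile_bounds₃ {e₀ : ℝ} (he : 0 < e₀) (n : ℕ) {d : ℝ} (hd1 : ∀ u, |deriv (bgmCutoffSq e₀) u| ≤ d)
    (hd2 : ∀ u, |iteratedDeriv 2 (bgmCutoffSq e₀) u| ≤ d) (hd3 : ∀ u, |iteratedDeriv 3 (bgmCutoffSq e₀) u| ≤ d) :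
    ContDiff ℝ 3 (fun u => bgmCutoffSq e₀ ((16 : ℝ) ^ n * u)) ∧ (∀ u, |bgmCutoffSq e₀ ((16 : ℝ) ^ n * u)| ≤ 1) ∧
      (∀ u, |deriv (fun u => bgmCutoffSq e₀ ((16 : ℝ) ^ n * u)) u| ≤ d * e₀ ^ 2 / klScale e₀ n ^ 2) ∧
      (∀ u, |iteratedDeriv 2 (fun u => bgmCutoffSq e₀ ((16 : ℝ) ^ n * u)) u| ≤ d * e₀ ^ 4 / klScale e₀ n ^ 4) ∧
      (∀ u, |iteratedDeriv 3 (fun u => bgmCutoffSq e₀ ((16 : ℝ) ^ n * u)) u| ≤ d * e₀ ^ 6 / klScale e₀ n ^ 6) ∧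
      (∀ u, klScale e₀ n ^ 2 < u → bgmCutoffSq e₀ ((16 : ℝ) ^ n * u) = 0) := by
  obtain ⟨-, h0, h1, h2, hv⟩ := scaleProfile_bounds he n hd1 hd2
  have hC : ContDiff ℝ 3 (bgmCutoffSq e₀) := contDiff_bgmCutoffSq he
  have h16 : (16 : ℝ) ^ n = e₀ ^ 2 / klScale e₀ n ^ 2 := sixteen_pow_eq n he.ne'
  refine ⟨hC.comp (contDiff_const.mul contDiff_id), h0, h1, h2, fun u => ?_, hv⟩
  rw [iteratedDeriv_three_comp_mul_left hC, abs_mul, abs_of_pos (by positivity : (0 : ℝ) < ((16 : ℝ) ^ n) ^ 3)]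
  calc ((16 : ℝ) ^ n) ^ 3 * |iteratedDeriv 3 (bgmCutoffSq e₀) ((16 : ℝ) ^ n * u)| ≤ ((16 : ℝ) ^ n) ^ 3 * d :=
        mul_le_mul_of_nonneg_left (hd3 _) (by positivity)
    _ = d * e₀ ^ 6 / klScale e₀ n ^ 6 := by rw [h16]; ring

/-! ### §3 The `C³` size of the frame band -/

/-- **`C³` size of the frame band**: if `‖D³(frameShift K)‖ ≤ A₃` on `Momentum` then `‖D³(p ↦ e_K(toLp p))(p)‖ ≤ 4 + 8A₃`
(`‖D³ε₀‖ ≤ 4`, `‖D³(δ_K ∘ toLp)‖ ≤ 2³A₃`). [folklore] -/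
theorem norm_iteratedFDeriv_three_frameBand_le {K : TrigPolyC4v} {A₃ : ℝ} (hA3 : ∀ p : Momentum, ‖iteratedFDeriv ℝ 3 (frameShift K) p‖ ≤ A₃)
    (μ : ℝ) (p : Fin 2 → ℝ) :
    ‖iteratedFDeriv ℝ 3 (fun p : Fin 2 → ℝ => frameLevel μ K (WithLp.toLp 2 p)) p‖ ≤ 4 + 8 * A₃ := by
  rw [frameBand_eq]
  have h1 : ContDiff ℝ 3 sqDispersion := contDiff_sqDispersion
  have h2 : ContDiff ℝ 3 (fun k : Fin 2 → ℝ => frameShift K (WithLp.toLp 2 k)) := contDiff_frameShift_toLp K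
  have hsum : iteratedFDeriv ℝ 3 (fun p => (sqDispersion p + frameShift K (WithLp.toLp 2 p)) + (-μ)) p =
      iteratedFDeriv ℝ 3 sqDispersion p + iteratedFDeriv ℝ 3 (fun k : Fin 2 → ℝ => frameShift K (WithLp.toLp 2 k)) p := by
    rw [fun_iteratedFDeriv_add_apply (f := fun p : Fin 2 → ℝ => sqDispersion p + frameShift K (WithLp.toLp 2 p))
      (g := fun _ : Fin 2 → ℝ => (-μ)) ((h1.add h2).contDiffAt) contDiffAt_const,
      iteratedFDeriv_const_of_ne (by norm_num) (-μ), Pi.zero_apply, add_zero,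
      fun_iteratedFDeriv_add_apply (f := sqDispersion) (g := fun k : Fin 2 → ℝ => frameShift K (WithLp.toLp 2 k))
        h1.contDiffAt h2.contDiffAt]
  rw [hsum]
  calc _ ≤ ‖iteratedFDeriv ℝ 3 sqDispersion p‖ + ‖iteratedFDeriv ℝ 3 (fun k : Fin 2 → ℝ => frameShift K (WithLp.toLp 2 k)) p‖ :=
        norm_add_le _ _
    _ ≤ 4 + A₃ * 2 ^ 3 := add_le_add (norm_iteratedFDeriv_sqDispersion_le 3 p) (norm_iteratedFDeriv_frameShift_toLp_le_single hA3 p)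
    _ = 4 + 8 * A₃ := by ring

/-- **The frame band is `C³`** (in fact smooth). [folklore] -/
theorem contDiff_three_frameBand (μ : ℝ) (K : TrigPolyC4v) : ContDiff ℝ 3 (fun p : Fin 2 → ℝ => frameLevel μ K (WithLp.toLp 2 p)) :=
  contDiff_frameBand μ K

end Summit.HubbardSuperconductivity.HubbardSuperconductivity.Theorems.TorusFourierL2

end
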